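import Summits.CriticalPhenomena.PercolationContinuityZ3.Theorems.PercNearOneGluingNoHeavyLowerTailSahiGridPatternBlockOrT

/-!
# `NoHeavyLowerTail` (crux stmt-CriticalPhenomena-4575), Sahi programme P1: **CONDITION (N) OF THE BLOCK-OR VECTORS IS ⪯-MONOTONE IN BOTH BLOCK CERTIFICATES**
# (the monotone-reduction lemma behind the OR-census: it suffices to test the ⪯-minimal certificates of the inner block, and validity ascends to every
# ⪰-larger certificate of the outer block)

Support file (Sahi cell, seat `prim-sahi-p1`, generation 35; `--supports stmt-CriticalPhenomena-4575`).  Pure proofs, no definitions, no `sorry`, standard axioms.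
Vocabulary of `…SahiGridPattern{,CellForm,DiagCert,DiagCertBlockAndT,CoCountProductT,BlockOrT}` (`glue`, `freeOf`, `cellOf`, `fibre`, `sect`, `ind`, `nuCount`, `thetaVal`).

THE MATHEMATICS (seat memos FROM-prim-sahi-p1-gen34 §3.2–§3.4 and its gen-35 AMENDMENT; census CENSUS.md §113(4)).  For `A = S ⊕ V ⊆ [3]^{n+k}`
(`glue ξ z ∈ A ↔ ξ ∈ S ∨ z ∈ V`) and block vectors `d_S`, `d_V` the block-OR vector of `…BlockOrT` is, at `x = glue ξ q`,
  `OR8(d_S,d_V)(x) = 1_S1_V·(2^{n+k} + h_S h_V) + 1_S(1−1_V)·(2^k d_S(ξ) − h_S(ξ)ν_V(q)) + (1−1_S)1_V·(2^k ν_S(ξ) + ν̄_S(ξ) d_V(q))`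
(`h = 2^{dim}1 − ν`, `ν̄_S = 2^n − ν_S ≥ 0`), and `OR8m` is the mirror (blocks exchanged).  Its condition (T) holds for all `d_S, d_V` with (T) (`diagCert_blockOr_T`);
its condition (N), `Θ_A(P×Q) ≤ OR8(d_S,d_V)(P∩Q)` for all up-sets `P, Q`, is NOT always true (gen-34/35 censuses) and depends on the certificates.  THIS FILE proves the
elementary but load-bearing fact that (N) is MONOTONE: the certificates enter `OR8` linearly with the nonnegative coefficients `2^k·1_S(1−1_V)` (for `d_S`) and
`ν̄_S(1−1_S)1_V` (for `d_V`), so for vectors vanishing off their blocks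
  `OR8(d_S',d_V')(W) − OR8(d_S,d_V)(W) = Σ_q 2^k(1−1_V(q))·(d_S'−d_S)(W_q) + Σ_ξ ν̄_S(ξ)(1−1_S(ξ))·(d_V'−d_V)(W^ξ)`  (fibres `W_q`, sections `W^ξ`),
which is `≥ 0` for every up-set `W` as soon as `d_S ⪯ d_S'` and `d_V ⪯ d_V'` in the up-set order (`d ⪯ d'` iff `d(X) ≤ d'(X)` for every up-set `X`)
(`blockOr_sum_mono`, and `blockOrMirror_sum_mono` for OR8m with coefficients `(2^k − ν_V(q))1_S(1−1_V)`, `2^n(1−1_S)1_V`).  CONSEQUENCES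
(`diagCert_blockOr_N_of_le`, `diagCert_blockOrMirror_N_of_le`, `diagCert_blockOrSym_N_of_le`): if (N) holds for `A` with the vector `OR8(d_S,d_V)` (resp. OR8m, resp. the
integral symmetric vector OR8 + OR8m against `2Θ_A`) then it holds with `OR8(d_S',d_V')` for all `d_S' ⪰ d_S`, `d_V' ⪰ d_V` vanishing off the blocks.  USE: (i) with
`…DiagCertLiteralOr` (the case `S = {t ≥ 1}`, `d_S = (0,2,2)`, every `V`) every certificate of the literal gives a valid block-OR step, since the literal's certificates
are the segment from `(0,2,2)` to the ⪯-larger `(0,1,3)`; (ii) the census reductions "(N) of OR8h is decided at the ⪯-minimal vertex pairs" (CENSUS §113(4)) and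
"OR-goodness of an outer certificate ascends to every ⪰-larger certificate" (seat memo gen 35).  Nothing here asserts (N) for any particular block-OR vector,
`PatternPos d` for `d ≥ 4`, or any conjecture of the memos. [this work]
-/

namespace Summit.CriticalPhenomena.PercolationContinuityZ3.Theorems.SahiGridPattern

open Finset SahiGrid3
open scoped BigOperators

variable {n k : ℕ} {S : Finset (Pd n)} {V : Finset (Pd k)} {A : Finset (Pd (n + k))}

/-! ### Pointwise differences -/

/-- **OR8 is affine in the certificates with nonnegative coefficients** (pointwise difference at a glued point). [this work] -/
theorem blockOr_sub_pointwise (dS dS' : Pd n → ℤ) (dV dV' : Pd k → ℤ) (ξ : Pd n) (q : Pd k) :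
    ( ind S ξ * ind V q * ((2:ℤ) ^ (n + k) + (2 ^ n * ind S ξ - (nuCount S ξ : ℤ)) * (2 ^ k * ind V q - (nuCount V q : ℤ)))
      + ind S ξ * (1 - ind V q) * (2 ^ k * dS' ξ - (2 ^ n * ind S ξ - (nuCount S ξ : ℤ)) * (nuCount V q : ℤ))
      + (1 - ind S ξ) * ind V q * (2 ^ k * (nuCount S ξ : ℤ) + (2 ^ n - (nuCount S ξ : ℤ)) * dV' q) )
    - ( ind S ξ * ind V q * ((2:ℤ) ^ (n + k) + (2 ^ n * ind S ξ - (nuCount S ξ : ℤ)) * (2 ^ k * ind V q - (nuCount V q : ℤ)))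
      + ind S ξ * (1 - ind V q) * (2 ^ k * dS ξ - (2 ^ n * ind S ξ - (nuCount S ξ : ℤ)) * (nuCount V q : ℤ))
      + (1 - ind S ξ) * ind V q * (2 ^ k * (nuCount S ξ : ℤ) + (2 ^ n - (nuCount S ξ : ℤ)) * dV q) )
    = 2 ^ k * (1 - ind V q) * (ind S ξ * (dS' ξ - dS ξ)) + (2 ^ n - (nuCount S ξ : ℤ)) * (1 - ind S ξ) * (ind V q * (dV' q - dV q)) := by
  ring

/-- **OR8m (mirror) is affine in the certificates with nonnegative coefficients** (pointwise difference at a glued point). [this work] -/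
theorem blockOrMirror_sub_pointwise (dS dS' : Pd n → ℤ) (dV dV' : Pd k → ℤ) (ξ : Pd n) (q : Pd k) :
    ( ind S ξ * ind V q * ((2:ℤ) ^ (n + k) + (2 ^ n * ind S ξ - (nuCount S ξ : ℤ)) * (2 ^ k * ind V q - (nuCount V q : ℤ)))
      + (1 - ind S ξ) * ind V q * (2 ^ n * dV' q - (2 ^ k * ind V q - (nuCount V q : ℤ)) * (nuCount S ξ : ℤ))
      + ind S ξ * (1 - ind V q) * (2 ^ n * (nuCount V q : ℤ) + (2 ^ k - (nuCount V q : ℤ)) * dS' ξ) )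
    - ( ind S ξ * ind V q * ((2:ℤ) ^ (n + k) + (2 ^ n * ind S ξ - (nuCount S ξ : ℤ)) * (2 ^ k * ind V q - (nuCount V q : ℤ)))
      + (1 - ind S ξ) * ind V q * (2 ^ n * dV q - (2 ^ k * ind V q - (nuCount V q : ℤ)) * (nuCount S ξ : ℤ))
      + ind S ξ * (1 - ind V q) * (2 ^ n * (nuCount V q : ℤ) + (2 ^ k - (nuCount V q : ℤ)) * dS ξ) )
    = (2 ^ k - (nuCount V q : ℤ)) * (1 - ind V q) * (ind S ξ * (dS' ξ - dS ξ)) + 2 ^ n * (1 - ind S ξ) * (ind V q * (dV' q - dV q)) := by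
  ring

/-- For a vector pair vanishing off `S`, `1_S·(d' − d) = d' − d`. [this work] -/
theorem ind_mul_sub_eq_of_zero_off (dS dS' : Pd n → ℤ) (hS0 : ∀ ξ, ξ ∉ S → dS ξ = 0) (hS0' : ∀ ξ, ξ ∉ S → dS' ξ = 0) (ξ : Pd n) :
    ind S ξ * (dS' ξ - dS ξ) = dS' ξ - dS ξ := by
  unfold ind
  by_cases h : ξ ∈ S
  · rw [if_pos h, one_mul]
  · rw [if_neg h, hS0 ξ h, hS0' ξ h]; ring

/-! ### Monotonicity of the up-set sums -/

/-- **Monotone lemma for OR8.**  If `d_S ⪯ d_S'` and `d_V ⪯ d_V'` in the up-set order (all four vanishing off their blocks), then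
`Σ_{x∈W} OR8(d_S,d_V)(x) ≤ Σ_{x∈W} OR8(d_S',d_V')(x)` for every up-set `W ⊆ [3]^{n+k}`. [this work] -/
theorem blockOr_sum_mono (dS dS' : Pd n → ℤ) (dV dV' : Pd k → ℤ)
    (hS0 : ∀ ξ, ξ ∉ S → dS ξ = 0) (hS0' : ∀ ξ, ξ ∉ S → dS' ξ = 0) (hV0 : ∀ q, q ∉ V → dV q = 0) (hV0' : ∀ q, q ∉ V → dV' q = 0)
    (hleS : ∀ X : Finset (Pd n), IsUpperSet (X : Set (Pd n)) → (∑ ξ ∈ X, dS ξ) ≤ ∑ ξ ∈ X, dS' ξ)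
    (hleV : ∀ Y : Finset (Pd k), IsUpperSet (Y : Set (Pd k)) → (∑ q ∈ Y, dV q) ≤ ∑ q ∈ Y, dV' q)
    {W : Finset (Pd (n + k))} (hW : IsUpperSet (W : Set (Pd (n + k)))) :
    (∑ x ∈ W,
      ( ind S (freeOf x) * ind V (cellOf x) * ((2:ℤ) ^ (n + k)
          + (2 ^ n * ind S (freeOf x) - (nuCount S (freeOf x) : ℤ)) * (2 ^ k * ind V (cellOf x) - (nuCount V (cellOf x) : ℤ)))
      + ind S (freeOf x) * (1 - ind V (cellOf x)) * (2 ^ k * dS (freeOf x) - (2 ^ n * ind S (freeOf x) - (nuCount S (freeOf x) : ℤ)) * (nuCount V (cellOf x) : ℤ))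
      + (1 - ind S (freeOf x)) * ind V (cellOf x) * (2 ^ k * (nuCount S (freeOf x) : ℤ) + (2 ^ n - (nuCount S (freeOf x) : ℤ)) * dV (cellOf x)) ))
    ≤ ∑ x ∈ W,
      ( ind S (freeOf x) * ind V (cellOf x) * ((2:ℤ) ^ (n + k)
          + (2 ^ n * ind S (freeOf x) - (nuCount S (freeOf x) : ℤ)) * (2 ^ k * ind V (cellOf x) - (nuCount V (cellOf x) : ℤ)))
      + ind S (freeOf x) * (1 - ind V (cellOf x)) * (2 ^ k * dS' (freeOf x) - (2 ^ n * ind S (freeOf x) - (nuCount S (freeOf x) : ℤ)) * (nuCount V (cellOf x) : ℤ))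
      + (1 - ind S (freeOf x)) * ind V (cellOf x) * (2 ^ k * (nuCount S (freeOf x) : ℤ) + (2 ^ n - (nuCount S (freeOf x) : ℤ)) * dV' (cellOf x)) ) := by
  rw [← sub_nonneg, ← Finset.sum_sub_distrib, sum_mem_eq_sum_glue]
  simp only [freeOf_glue, cellOf_glue]
  have hpt : ∀ (ξ : Pd n) (q : Pd k), ind W (glue ξ q) *
      (( ind S ξ * ind V q * ((2:ℤ) ^ (n + k) + (2 ^ n * ind S ξ - (nuCount S ξ : ℤ)) * (2 ^ k * ind V q - (nuCount V q : ℤ)))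
        + ind S ξ * (1 - ind V q) * (2 ^ k * dS' ξ - (2 ^ n * ind S ξ - (nuCount S ξ : ℤ)) * (nuCount V q : ℤ))
        + (1 - ind S ξ) * ind V q * (2 ^ k * (nuCount S ξ : ℤ) + (2 ^ n - (nuCount S ξ : ℤ)) * dV' q) )
      - ( ind S ξ * ind V q * ((2:ℤ) ^ (n + k) + (2 ^ n * ind S ξ - (nuCount S ξ : ℤ)) * (2 ^ k * ind V q - (nuCount V q : ℤ)))
        + ind S ξ * (1 - ind V q) * (2 ^ k * dS ξ - (2 ^ n * ind S ξ - (nuCount S ξ : ℤ)) * (nuCount V q : ℤ))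
        + (1 - ind S ξ) * ind V q * (2 ^ k * (nuCount S ξ : ℤ) + (2 ^ n - (nuCount S ξ : ℤ)) * dV q) ))
      = 2 ^ k * (1 - ind V q) * (ind W (glue ξ q) * (dS' ξ - dS ξ))
        + (2 ^ n - (nuCount S ξ : ℤ)) * (1 - ind S ξ) * (ind W (glue ξ q) * (dV' q - dV q)) := by
    intro ξ q
    rw [blockOr_sub_pointwise, ind_mul_sub_eq_of_zero_off dS dS' hS0 hS0' ξ, ind_mul_sub_eq_of_zero_off dV dV' hV0 hV0' q]
    ring
  simp only [hpt, Finset.sum_add_distrib]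
  -- `S`-block: fibres `W_q`, weight `2^k (1 − 1_V(q)) ≥ 0`
  have h1 : 0 ≤ ∑ ξ : Pd n, ∑ q : Pd k, 2 ^ k * (1 - ind V q) * (ind W (glue ξ q) * (dS' ξ - dS ξ)) := by
    rw [Finset.sum_comm]
    refine Finset.sum_nonneg fun q _ => ?_
    rw [← Finset.mul_sum, sum_ind_glue_mul_eq_sum_fibre, Finset.sum_sub_distrib]
    have hv : (0:ℤ) ≤ 1 - ind V q := by unfold ind; split_ifs <;> norm_num
    refine mul_nonneg (mul_nonneg (pow_nonneg (by norm_num) k) hv) ?_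
    linarith [hleS (fibre W q) (isUpperSet_fibre hW q)]
  -- `V`-block: sections `W^ξ`, weight `ν̄_S(ξ)(1 − 1_S(ξ)) ≥ 0`
  have h2 : 0 ≤ ∑ ξ : Pd n, ∑ q : Pd k, (2 ^ n - (nuCount S ξ : ℤ)) * (1 - ind S ξ) * (ind W (glue ξ q) * (dV' q - dV q)) := by
    refine Finset.sum_nonneg fun ξ _ => ?_
    rw [← Finset.mul_sum, sum_ind_glue_mul_eq_sum_sect, Finset.sum_sub_distrib]
    have hs : (0:ℤ) ≤ 1 - ind S ξ := by unfold ind; split_ifs <;> norm_num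
    have hν : (0:ℤ) ≤ 2 ^ n - (nuCount S ξ : ℤ) := by linarith [nuCount_le_two_pow S ξ]
    refine mul_nonneg (mul_nonneg hν hs) ?_
    linarith [hleV (sect W ξ) (isUpperSet_sect hW ξ)]
  linarith

/-- **Monotone lemma for OR8m (mirror).**  Same statement for the mirrored block-OR vector. [this work] -/
theorem blockOrMirror_sum_mono (dS dS' : Pd n → ℤ) (dV dV' : Pd k → ℤ)
    (hS0 : ∀ ξ, ξ ∉ S → dS ξ = 0) (hS0' : ∀ ξ, ξ ∉ S → dS' ξ = 0) (hV0 : ∀ q, q ∉ V → dV q = 0) (hV0' : ∀ q, q ∉ V → dV' q = 0)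
    (hleS : ∀ X : Finset (Pd n), IsUpperSet (X : Set (Pd n)) → (∑ ξ ∈ X, dS ξ) ≤ ∑ ξ ∈ X, dS' ξ)
    (hleV : ∀ Y : Finset (Pd k), IsUpperSet (Y : Set (Pd k)) → (∑ q ∈ Y, dV q) ≤ ∑ q ∈ Y, dV' q)
    {W : Finset (Pd (n + k))} (hW : IsUpperSet (W : Set (Pd (n + k)))) :
    (∑ x ∈ W,
      ( ind S (freeOf x) * ind V (cellOf x) * ((2:ℤ) ^ (n + k)
          + (2 ^ n * ind S (freeOf x) - (nuCount S (freeOf x) : ℤ)) * (2 ^ k * ind V (cellOf x) - (nuCount V (cellOf x) : ℤ)))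
      + (1 - ind S (freeOf x)) * ind V (cellOf x) * (2 ^ n * dV (cellOf x) - (2 ^ k * ind V (cellOf x) - (nuCount V (cellOf x) : ℤ)) * (nuCount S (freeOf x) : ℤ))
      + ind S (freeOf x) * (1 - ind V (cellOf x)) * (2 ^ n * (nuCount V (cellOf x) : ℤ) + (2 ^ k - (nuCount V (cellOf x) : ℤ)) * dS (freeOf x)) ))
    ≤ ∑ x ∈ W,
      ( ind S (freeOf x) * ind V (cellOf x) * ((2:ℤ) ^ (n + k)
          + (2 ^ n * ind S (freeOf x) - (nuCount S (freeOf x) : ℤ)) * (2 ^ k * ind V (cellOf x) - (nuCount V (cellOf x) : ℤ)))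
      + (1 - ind S (freeOf x)) * ind V (cellOf x) * (2 ^ n * dV' (cellOf x) - (2 ^ k * ind V (cellOf x) - (nuCount V (cellOf x) : ℤ)) * (nuCount S (freeOf x) : ℤ))
      + ind S (freeOf x) * (1 - ind V (cellOf x)) * (2 ^ n * (nuCount V (cellOf x) : ℤ) + (2 ^ k - (nuCount V (cellOf x) : ℤ)) * dS' (freeOf x)) ) := by
  rw [← sub_nonneg, ← Finset.sum_sub_distrib, sum_mem_eq_sum_glue]
  simp only [freeOf_glue, cellOf_glue]
  have hpt : ∀ (ξ : Pd n) (q : Pd k), ind W (glue ξ q) *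
      (( ind S ξ * ind V q * ((2:ℤ) ^ (n + k) + (2 ^ n * ind S ξ - (nuCount S ξ : ℤ)) * (2 ^ k * ind V q - (nuCount V q : ℤ)))
        + (1 - ind S ξ) * ind V q * (2 ^ n * dV' q - (2 ^ k * ind V q - (nuCount V q : ℤ)) * (nuCount S ξ : ℤ))
        + ind S ξ * (1 - ind V q) * (2 ^ n * (nuCount V q : ℤ) + (2 ^ k - (nuCount V q : ℤ)) * dS' ξ) )
      - ( ind S ξ * ind V q * ((2:ℤ) ^ (n + k) + (2 ^ n * ind S ξ - (nuCount S ξ : ℤ)) * (2 ^ k * ind V q - (nuCount V q : ℤ)))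
        + (1 - ind S ξ) * ind V q * (2 ^ n * dV q - (2 ^ k * ind V q - (nuCount V q : ℤ)) * (nuCount S ξ : ℤ))
        + ind S ξ * (1 - ind V q) * (2 ^ n * (nuCount V q : ℤ) + (2 ^ k - (nuCount V q : ℤ)) * dS ξ) ))
      = (2 ^ k - (nuCount V q : ℤ)) * (1 - ind V q) * (ind W (glue ξ q) * (dS' ξ - dS ξ))
        + 2 ^ n * (1 - ind S ξ) * (ind W (glue ξ q) * (dV' q - dV q)) := by
    intro ξ q
    rw [blockOrMirror_sub_pointwise, ind_mul_sub_eq_of_zero_off dS dS' hS0 hS0' ξ, ind_mul_sub_eq_of_zero_off dV dV' hV0 hV0' q]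
    ring
  simp only [hpt, Finset.sum_add_distrib]
  have h1 : 0 ≤ ∑ ξ : Pd n, ∑ q : Pd k, (2 ^ k - (nuCount V q : ℤ)) * (1 - ind V q) * (ind W (glue ξ q) * (dS' ξ - dS ξ)) := by
    rw [Finset.sum_comm]
    refine Finset.sum_nonneg fun q _ => ?_
    rw [← Finset.mul_sum, sum_ind_glue_mul_eq_sum_fibre, Finset.sum_sub_distrib]
    have hv : (0:ℤ) ≤ 1 - ind V q := by unfold ind; split_ifs <;> norm_num
    have hν : (0:ℤ) ≤ 2 ^ k - (nuCount V q : ℤ) := by linarith [nuCount_le_two_pow V q]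
    refine mul_nonneg (mul_nonneg hν hv) ?_
    linarith [hleS (fibre W q) (isUpperSet_fibre hW q)]
  have h2 : 0 ≤ ∑ ξ : Pd n, ∑ q : Pd k, 2 ^ n * (1 - ind S ξ) * (ind W (glue ξ q) * (dV' q - dV q)) := by
    refine Finset.sum_nonneg fun ξ _ => ?_
    rw [← Finset.mul_sum, sum_ind_glue_mul_eq_sum_sect, Finset.sum_sub_distrib]
    have hs : (0:ℤ) ≤ 1 - ind S ξ := by unfold ind; split_ifs <;> norm_num
    refine mul_nonneg (mul_nonneg (pow_nonneg (by norm_num) n) hs) ?_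
    linarith [hleV (sect W ξ) (isUpperSet_sect hW ξ)]
  linarith

/-! ### Consequences for condition (N) -/

/-- **(N) for OR8 ascends along ⪯ in both certificates.**  If `Θ_A(P×Q) ≤ OR8(d_S,d_V)(P∩Q)` for all up-sets `P, Q` and `d_S ⪯ d_S'`, `d_V ⪯ d_V'`
(all vanishing off their blocks), then `Θ_A(P×Q) ≤ OR8(d_S',d_V')(P∩Q)` for all up-sets `P, Q`.  (`A` is arbitrary here: only the right-hand side changes.) [this work] -/
theorem diagCert_blockOr_N_of_le (dS dS' : Pd n → ℤ) (dV dV' : Pd k → ℤ)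
    (hS0 : ∀ ξ, ξ ∉ S → dS ξ = 0) (hS0' : ∀ ξ, ξ ∉ S → dS' ξ = 0) (hV0 : ∀ q, q ∉ V → dV q = 0) (hV0' : ∀ q, q ∉ V → dV' q = 0)
    (hleS : ∀ X : Finset (Pd n), IsUpperSet (X : Set (Pd n)) → (∑ ξ ∈ X, dS ξ) ≤ ∑ ξ ∈ X, dS' ξ)
    (hleV : ∀ Y : Finset (Pd k), IsUpperSet (Y : Set (Pd k)) → (∑ q ∈ Y, dV q) ≤ ∑ q ∈ Y, dV' q)
    (hN : ∀ P Q : Finset (Pd (n + k)), IsUpperSet (P : Set (Pd (n + k))) → IsUpperSet (Q : Set (Pd (n + k))) →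
      (∑ x ∈ P, ∑ y ∈ Q, thetaVal A x y) ≤ ∑ x ∈ P ∩ Q,
        ( ind S (freeOf x) * ind V (cellOf x) * ((2:ℤ) ^ (n + k)
            + (2 ^ n * ind S (freeOf x) - (nuCount S (freeOf x) : ℤ)) * (2 ^ k * ind V (cellOf x) - (nuCount V (cellOf x) : ℤ)))
        + ind S (freeOf x) * (1 - ind V (cellOf x)) * (2 ^ k * dS (freeOf x) - (2 ^ n * ind S (freeOf x) - (nuCount S (freeOf x) : ℤ)) * (nuCount V (cellOf x) : ℤ))
        + (1 - ind S (freeOf x)) * ind V (cellOf x) * (2 ^ k * (nuCount S (freeOf x) : ℤ) + (2 ^ n - (nuCount S (freeOf x) : ℤ)) * dV (cellOf x)) ))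
    {P Q : Finset (Pd (n + k))} (hP : IsUpperSet (P : Set (Pd (n + k)))) (hQ : IsUpperSet (Q : Set (Pd (n + k)))) :
    (∑ x ∈ P, ∑ y ∈ Q, thetaVal A x y) ≤ ∑ x ∈ P ∩ Q,
        ( ind S (freeOf x) * ind V (cellOf x) * ((2:ℤ) ^ (n + k)
            + (2 ^ n * ind S (freeOf x) - (nuCount S (freeOf x) : ℤ)) * (2 ^ k * ind V (cellOf x) - (nuCount V (cellOf x) : ℤ)))
        + ind S (freeOf x) * (1 - ind V (cellOf x)) * (2 ^ k * dS' (freeOf x) - (2 ^ n * ind S (freeOf x) - (nuCount S (freeOf x) : ℤ)) * (nuCount V (cellOf x) : ℤ))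
        + (1 - ind S (freeOf x)) * ind V (cellOf x) * (2 ^ k * (nuCount S (freeOf x) : ℤ) + (2 ^ n - (nuCount S (freeOf x) : ℤ)) * dV' (cellOf x)) ) :=
  le_trans (hN P Q hP hQ) (blockOr_sum_mono dS dS' dV dV' hS0 hS0' hV0 hV0' hleS hleV (isUpperSet_inter_coe hP hQ))

/-- **(N) for OR8m ascends along ⪯ in both certificates** (mirror statement). [this work] -/
theorem diagCert_blockOrMirror_N_of_le (dS dS' : Pd n → ℤ) (dV dV' : Pd k → ℤ)
    (hS0 : ∀ ξ, ξ ∉ S → dS ξ = 0) (hS0' : ∀ ξ, ξ ∉ S → dS' ξ = 0) (hV0 : ∀ q, q ∉ V → dV q = 0) (hV0' : ∀ q, q ∉ V → dV' q = 0)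
    (hleS : ∀ X : Finset (Pd n), IsUpperSet (X : Set (Pd n)) → (∑ ξ ∈ X, dS ξ) ≤ ∑ ξ ∈ X, dS' ξ)
    (hleV : ∀ Y : Finset (Pd k), IsUpperSet (Y : Set (Pd k)) → (∑ q ∈ Y, dV q) ≤ ∑ q ∈ Y, dV' q)
    (hN : ∀ P Q : Finset (Pd (n + k)), IsUpperSet (P : Set (Pd (n + k))) → IsUpperSet (Q : Set (Pd (n + k))) →
      (∑ x ∈ P, ∑ y ∈ Q, thetaVal A x y) ≤ ∑ x ∈ P ∩ Q,
        ( ind S (freeOf x) * ind V (cellOf x) * ((2:ℤ) ^ (n + k)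
            + (2 ^ n * ind S (freeOf x) - (nuCount S (freeOf x) : ℤ)) * (2 ^ k * ind V (cellOf x) - (nuCount V (cellOf x) : ℤ)))
        + (1 - ind S (freeOf x)) * ind V (cellOf x) * (2 ^ n * dV (cellOf x) - (2 ^ k * ind V (cellOf x) - (nuCount V (cellOf x) : ℤ)) * (nuCount S (freeOf x) : ℤ))
        + ind S (freeOf x) * (1 - ind V (cellOf x)) * (2 ^ n * (nuCount V (cellOf x) : ℤ) + (2 ^ k - (nuCount V (cellOf x) : ℤ)) * dS (freeOf x)) ))
    {P Q : Finset (Pd (n + k))} (hP : IsUpperSet (P : Set (Pd (n + k)))) (hQ : IsUpperSet (Q : Set (Pd (n + k)))) :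
    (∑ x ∈ P, ∑ y ∈ Q, thetaVal A x y) ≤ ∑ x ∈ P ∩ Q,
        ( ind S (freeOf x) * ind V (cellOf x) * ((2:ℤ) ^ (n + k)
            + (2 ^ n * ind S (freeOf x) - (nuCount S (freeOf x) : ℤ)) * (2 ^ k * ind V (cellOf x) - (nuCount V (cellOf x) : ℤ)))
        + (1 - ind S (freeOf x)) * ind V (cellOf x) * (2 ^ n * dV' (cellOf x) - (2 ^ k * ind V (cellOf x) - (nuCount V (cellOf x) : ℤ)) * (nuCount S (freeOf x) : ℤ))
        + ind S (freeOf x) * (1 - ind V (cellOf x)) * (2 ^ n * (nuCount V (cellOf x) : ℤ) + (2 ^ k - (nuCount V (cellOf x) : ℤ)) * dS' (freeOf x)) ) :=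
  le_trans (hN P Q hP hQ) (blockOrMirror_sum_mono dS dS' dV dV' hS0 hS0' hV0 hV0' hleS hleV (isUpperSet_inter_coe hP hQ))

/-- **(N) for the integral symmetric vector OR8 + OR8m (= 2·OR8h, tested against `2Θ_A`) ascends along ⪯ in both certificates.** [this work] -/
theorem diagCert_blockOrSym_N_of_le (dS dS' : Pd n → ℤ) (dV dV' : Pd k → ℤ)
    (hS0 : ∀ ξ, ξ ∉ S → dS ξ = 0) (hS0' : ∀ ξ, ξ ∉ S → dS' ξ = 0) (hV0 : ∀ q, q ∉ V → dV q = 0) (hV0' : ∀ q, q ∉ V → dV' q = 0)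
    (hleS : ∀ X : Finset (Pd n), IsUpperSet (X : Set (Pd n)) → (∑ ξ ∈ X, dS ξ) ≤ ∑ ξ ∈ X, dS' ξ)
    (hleV : ∀ Y : Finset (Pd k), IsUpperSet (Y : Set (Pd k)) → (∑ q ∈ Y, dV q) ≤ ∑ q ∈ Y, dV' q)
    (hN : ∀ P Q : Finset (Pd (n + k)), IsUpperSet (P : Set (Pd (n + k))) → IsUpperSet (Q : Set (Pd (n + k))) →
      2 * (∑ x ∈ P, ∑ y ∈ Q, thetaVal A x y) ≤ ∑ x ∈ P ∩ Q,
        (( ind S (freeOf x) * ind V (cellOf x) * ((2:ℤ) ^ (n + k)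
            + (2 ^ n * ind S (freeOf x) - (nuCount S (freeOf x) : ℤ)) * (2 ^ k * ind V (cellOf x) - (nuCount V (cellOf x) : ℤ)))
        + ind S (freeOf x) * (1 - ind V (cellOf x)) * (2 ^ k * dS (freeOf x) - (2 ^ n * ind S (freeOf x) - (nuCount S (freeOf x) : ℤ)) * (nuCount V (cellOf x) : ℤ))
        + (1 - ind S (freeOf x)) * ind V (cellOf x) * (2 ^ k * (nuCount S (freeOf x) : ℤ) + (2 ^ n - (nuCount S (freeOf x) : ℤ)) * dV (cellOf x)) )
        + ( ind S (freeOf x) * ind V (cellOf x) * ((2:ℤ) ^ (n + k)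
            + (2 ^ n * ind S (freeOf x) - (nuCount S (freeOf x) : ℤ)) * (2 ^ k * ind V (cellOf x) - (nuCount V (cellOf x) : ℤ)))
        + (1 - ind S (freeOf x)) * ind V (cellOf x) * (2 ^ n * dV (cellOf x) - (2 ^ k * ind V (cellOf x) - (nuCount V (cellOf x) : ℤ)) * (nuCount S (freeOf x) : ℤ))
        + ind S (freeOf x) * (1 - ind V (cellOf x)) * (2 ^ n * (nuCount V (cellOf x) : ℤ) + (2 ^ k - (nuCount V (cellOf x) : ℤ)) * dS (freeOf x)) )))
    {P Q : Finset (Pd (n + k))} (hP : IsUpperSet (P : Set (Pd (n + k)))) (hQ : IsUpperSet (Q : Set (Pd (n + k)))) :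
    2 * (∑ x ∈ P, ∑ y ∈ Q, thetaVal A x y) ≤ ∑ x ∈ P ∩ Q,
        (( ind S (freeOf x) * ind V (cellOf x) * ((2:ℤ) ^ (n + k)
            + (2 ^ n * ind S (freeOf x) - (nuCount S (freeOf x) : ℤ)) * (2 ^ k * ind V (cellOf x) - (nuCount V (cellOf x) : ℤ)))
        + ind S (freeOf x) * (1 - ind V (cellOf x)) * (2 ^ k * dS' (freeOf x) - (2 ^ n * ind S (freeOf x) - (nuCount S (freeOf x) : ℤ)) * (nuCount V (cellOf x) : ℤ))
        + (1 - ind S (freeOf x)) * ind V (cellOf x) * (2 ^ k * (nuCount S (freeOf x) : ℤ) + (2 ^ n - (nuCount S (freeOf x) : ℤ)) * dV' (cellOf x)) )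
        + ( ind S (freeOf x) * ind V (cellOf x) * ((2:ℤ) ^ (n + k)
            + (2 ^ n * ind S (freeOf x) - (nuCount S (freeOf x) : ℤ)) * (2 ^ k * ind V (cellOf x) - (nuCount V (cellOf x) : ℤ)))
        + (1 - ind S (freeOf x)) * ind V (cellOf x) * (2 ^ n * dV' (cellOf x) - (2 ^ k * ind V (cellOf x) - (nuCount V (cellOf x) : ℤ)) * (nuCount S (freeOf x) : ℤ))
        + ind S (freeOf x) * (1 - ind V (cellOf x)) * (2 ^ n * (nuCount V (cellOf x) : ℤ) + (2 ^ k - (nuCount V (cellOf x) : ℤ)) * dS' (freeOf x)) )) := by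
  have hW := isUpperSet_inter_coe hP hQ
  have h1 := blockOr_sum_mono (S := S) (V := V) dS dS' dV dV' hS0 hS0' hV0 hV0' hleS hleV hW
  have h2 := blockOrMirror_sum_mono (S := S) (V := V) dS dS' dV dV' hS0 hS0' hV0 hV0' hleS hleV hW
  have h0 := hN P Q hP hQ
  rw [Finset.sum_add_distrib] at h0 ⊢
  linarith

end Summit.CriticalPhenomena.PercolationContinuityZ3.Theorems.SahiGridPattern
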